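import Summits.CriticalPhenomena.PercolationContinuityZ3.Theorems.PercFiniteBoxLRORenormaliseFromLinearLRODefs
import Literature.Probability.Percolation.SharpnessDCTProofs

/-!
# Crux `PercFiniteBoxLRO.RenormaliseFromLinearLRO` (stmt-CriticalPhenomena-0857), line `registered`,
# reshape 2 — objects: the GENERIC planar block coarse-graining of a block event, and the DENSE block

Definitions (and their elementary plumbing) shared by the helper files of reshape 2 of the line
`registered` of crux stmt-CriticalPhenomena-0857; lands `--supports stmt-CriticalPhenomena-0857` and proves
the registered stub `stub_denseLocal`.  All later files of the reshape are definition-free.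

* GENERIC COARSE-GRAINING of ANY block event `E ⊆ {0,1}^{E(ℤ³)}` (read "at the origin"): `blockEvent n E a`
  (its translate to the block `a ∈ ℤ²` of the planar layer with centres `blockCentre n a = n·(a₀, a₁, 0)` of
  the objects file `…Defs.lean`, p147463), `blockCfg n E ω ⊆ E(ℤ²)` (`{a, a + eᵢ}` open iff both blocks
  satisfy `E`), `blockLaw n E p = (blockCfg n E)_* P_p`.  The good-box objects of reshape 1 are the instance
  `E = goodBox n` (`goodBlock_eq_blockEvent`, `coarseCfg_eq_blockCfg`, `coarseLaw_eq_blockLaw`, all `rfl`).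
* THE DENSE BLOCK (replacing Grimmett's good box `G_n`).  Scales: local scale `s`, grid size `m`, core
  `Λ(n)` with `n = (2s+1)·m`, block region `Λ(K n)`.  `coreGrid s m = (2s+1)·Λ(m) = Λ(n) ∩ (2s+1)ℤ³` (grid
  points are `≥ 2s+1` apart, so their one-arm events `DCT16.armEvent y s` — "`y` is locally large" — use
  pairwise disjoint sets of pairs); `halfGrid s m i b` = the grid of the overlap half `{0 ≤ x_i}` / `{x_i ≤ 0}`
  of the core with the core of the neighbouring block `± eᵢ`; `largeCount`, `joinedCount` count the locally
  large points of a set, resp. those also joined to a base point inside a region; `denseBox K s m` — SOME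
  base point is joined inside `Λ(K n)` to a STRICT MAJORITY of the locally large points of EACH half-grid.
  Dense neighbouring blocks glue by pigeonhole (two strict majorities of one finite set meet), so the same-`p`
  criterion for this event needs no in-box uniqueness clause.

Sources: G. Grimmett, *Percolation*, 2nd ed. (1999), §7.4 pp.177–181 ((7.57)–(7.58)); H. Duminil-Copin,
V. Sidoravicius, V. Tassion, CPAM 69 (2016) §2.2; H. Duminil-Copin, G. Kozma, V. Tassion (2020) §1.1
(finite-size criteria and the uniqueness difficulty); G. Kozma, S. Nitzan, arXiv:2401.12397 §1.  The dense
block and its pigeonhole gluing are this line's device (lead c1, 2026-08-17).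
-/

noncomputable section

namespace Summit.CriticalPhenomena.PercolationContinuityZ3.Theorems.RenormaliseFromLinearLRO

open Literature.Probability.Percolation Literature.Probability.LatticeModels
open MeasureTheory

/-! ## Generic planar block coarse-graining of a block event -/

/-- The translate of the block event `E` (an event about the configuration near the origin) to the
block `a ∈ ℤ²`: `ω ∈ blockEvent n E a` iff the configuration shifted back by the centre,
`relabel (shift (-blockCentre n a)) ω` (`s(x, y) ∈ · ↔ s(x + c, y + c) ∈ ω`), lies in `E`
(Grimmett 1999, §7.4 (7.58), for a general block event). -/
def blockEvent (n : ℕ) (E : Set (BondConfig (Site 3))) (a : Site 2) : Set (BondConfig (Site 3)) :=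
  (BondConfig.relabel (sym2Equiv (Site.shift (-blockCentre n a)))) ⁻¹' E

/-- The coarse configuration on `ℤ²` of the block event `E`: the nearest-neighbour edge `{a, a + eᵢ}`
is open iff both blocks `a` and `a + eᵢ` satisfy `E` (DST 2016 §2.2 shape; Grimmett 1999 p.178). -/
def blockCfg (n : ℕ) (E : Set (BondConfig (Site 3))) (ω : BondConfig (Site 3)) : BondConfig (Site 2) :=
  {e | ∃ (a : Site 2) (i : Fin 2), e = s(a, a + Pi.single i 1) ∧
    ω ∈ blockEvent n E a ∧ ω ∈ blockEvent n E (a + Pi.single i 1)}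

/-- The law of the coarse configuration of `E` under `P_p` (a dependent bond percolation on `ℤ²`). -/
def blockLaw (n : ℕ) (E : Set (BondConfig (Site 3))) (p : unitInterval) : Measure (BondConfig (Site 2)) :=
  (bondPercolation (zdGraph 3) p).map (blockCfg n E)

/-- The good blocks of reshape 1 are the instance `E = goodBox n` of `blockEvent`. -/
theorem goodBlock_eq_blockEvent (n : ℕ) (a : Site 2) : goodBlock n a = blockEvent n (goodBox n) a := rfl

/-- The coarse good-edge configuration of reshape 1 is the instance `E = goodBox n` of `blockCfg`. -/
theorem coarseCfg_eq_blockCfg (n : ℕ) : coarseCfg n = blockCfg n (goodBox n) := rfl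

/-- The coarse law of reshape 1 is the instance `E = goodBox n` of `blockLaw`. -/
theorem coarseLaw_eq_blockLaw (n : ℕ) (p : unitInterval) : coarseLaw n p = blockLaw n (goodBox n) p := rfl

/-- Translates of a measurable block event are measurable. -/
theorem measurableSet_blockEvent (n : ℕ) {E : Set (BondConfig (Site 3))} (hE : MeasurableSet E)
    (a : Site 2) : MeasurableSet (blockEvent n E a) :=
  hE.preimage (BondConfig.relabel (sym2Equiv (Site.shift (-blockCentre n a)))).measurable

/-- Translation invariance: every block satisfies `E` with probability `P_p(E)`
(`bondPercolation_real_preimage_shift`; Grimmett 1999 §1.6). -/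
theorem real_blockEvent (n : ℕ) (E : Set (BondConfig (Site 3))) (p : unitInterval) (a : Site 2) :
    (bondPercolation (zdGraph 3) p).real (blockEvent n E a) = (bondPercolation (zdGraph 3) p).real E :=
  bondPercolation_real_preimage_shift (-blockCentre n a) p E

/-- Membership of a presented coarse edge in the coarse configuration (unique presentation of the
lattice edges `{a, a + eᵢ}`, `coarseEdge_eq_iff`). -/
theorem mk_mem_blockCfg_iff (n : ℕ) (E : Set (BondConfig (Site 3))) (ω : BondConfig (Site 3))
    (a : Site 2) (i : Fin 2) :
    s(a, a + Pi.single i 1) ∈ blockCfg n E ω ↔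
      ω ∈ blockEvent n E a ∧ ω ∈ blockEvent n E (a + Pi.single i 1) := by
  constructor
  · rintro ⟨a', j, he, h1, h2⟩
    obtain ⟨rfl, rfl⟩ := (coarseEdge_eq_iff a a' i j).1 he
    exact ⟨h1, h2⟩
  · rintro ⟨h1, h2⟩
    exact ⟨a, i, rfl, h1, h2⟩

/-- The coarse configuration of a measurable block event is a measurable function of the
configuration (port of `measurable_coarseCfg`). -/
theorem measurable_blockCfg (n : ℕ) {E : Set (BondConfig (Site 3))} (hE : MeasurableSet E) :
    Measurable (blockCfg n E) := by
  refine measurable_set_iff.2 fun e => ?_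
  refine measurableSet_setOf.1 ?_
  have : {ω : BondConfig (Site 3) | e ∈ blockCfg n E ω} =
      ⋃ a : Site 2, ⋃ i : Fin 2,
        {ω | e = s(a, a + Pi.single i 1) ∧ (ω ∈ blockEvent n E a ∧ ω ∈ blockEvent n E (a + Pi.single i 1))} := by
    ext ω
    simp only [blockCfg, Set.mem_setOf_eq, Set.mem_iUnion]
  rw [this]
  refine MeasurableSet.iUnion fun a => MeasurableSet.iUnion fun i => ?_
  by_cases he : e = s(a, a + Pi.single i 1)
  · simp only [he, true_and]
    exact (measurableSet_blockEvent n hE a).inter (measurableSet_blockEvent n hE _)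
  · simp only [he, false_and, Set.setOf_false]
    exact MeasurableSet.empty

/-- The coarse law of a measurable block event is a probability measure. -/
theorem isProbabilityMeasure_blockLaw (n : ℕ) {E : Set (BondConfig (Site 3))} (hE : MeasurableSet E)
    (p : unitInterval) : IsProbabilityMeasure (blockLaw n E p) :=
  Measure.isProbabilityMeasure_map (measurable_blockCfg n hE).aemeasurable

/-! ## The dense block -/

/-- The grid point `(2s+1)·z` of the grid `(2s+1)ℤ³` of mesh `2s+1`. -/
def gridPt (s : ℕ) (z : Site 3) : Site 3 := fun i => ((2 * s + 1 : ℕ) : ℤ) * z i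

/-- The core grid `(2s+1)·Λ(m) = Λ((2s+1)m) ∩ (2s+1)ℤ³` of the block of grid size `m`. -/
def coreGrid (s m : ℕ) : Finset (Site 3) := (box 3 m).image (gridPt s)

/-- The four half-grids of the core: the grid points `x` with `0 ≤ x_i` (`b = true`) resp. `x_i ≤ 0`
(`b = false`), `i : Fin 2` a planar direction — the grid of the overlap of the core `Λ(n)` with the
core `± n eᵢ + Λ(n)` of the neighbouring block. -/
def halfGrid (s m : ℕ) (i : Fin 2) (b : Bool) : Finset (Site 3) :=
  (coreGrid s m).filter fun x => if b then 0 ≤ x (Fin.castSucc i) else x (Fin.castSucc i) ≤ 0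

open Classical in
/-- The points of `G` that are locally large at scale `s` in `ω`, i.e. joined inside `y + Λ(s)` to
`y + ∂Λ(s)` (the translated one-arm event `DCT16.armEvent y s`). -/
def largeSet (s : ℕ) (G : Finset (Site 3)) (ω : BondConfig (Site 3)) : Finset (Site 3) :=
  G.filter fun y => ω ∈ DCT16.armEvent y s

open Classical in
/-- The points of `G` that are locally large at scale `s` and joined to `x` inside `S` in `ω`. -/
def joinedSet (s : ℕ) (S : Set (Site 3)) (G : Finset (Site 3)) (x : Site 3)
    (ω : BondConfig (Site 3)) : Finset (Site 3) :=
  G.filter fun y => ω ∈ DCT16.armEvent y s ∧ ω ∈ openConnIn S x y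

/-- The number of points of `G` that are locally large at scale `s`. -/
def largeCount (s : ℕ) (G : Finset (Site 3)) (ω : BondConfig (Site 3)) : ℕ := (largeSet s G ω).card

/-- The number of points of `G` that are locally large at scale `s` and joined to `x` inside `S`. -/
def joinedCount (s : ℕ) (S : Set (Site 3)) (G : Finset (Site 3)) (x : Site 3)
    (ω : BondConfig (Site 3)) : ℕ :=
  (joinedSet s S G x ω).card

/-- **The dense-block event** `D(K, s, m)` at the origin, `n = (2s+1)m`: some base point `x` is joined
inside `Λ(K n)` to a strict majority of the locally large points of each of the four half-grids of the
core `Λ(n)`. -/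
def denseBox (K s m : ℕ) : Set (BondConfig (Site 3)) :=
  {ω | ∃ x : Site 3, ∀ (i : Fin 2) (b : Bool),
    largeCount s (halfGrid s m i b) ω <
      2 * joinedCount s ↑(box 3 (K * ((2 * s + 1) * m))) (halfGrid s m i b) x ω}

/-! ## Elementary facts about the counted sets -/

/-- Membership in `largeSet`. -/
theorem mem_largeSet {s : ℕ} {G : Finset (Site 3)} {ω : BondConfig (Site 3)} {y : Site 3} :
    y ∈ largeSet s G ω ↔ y ∈ G ∧ ω ∈ DCT16.armEvent y s := by
  simp only [largeSet, Finset.mem_filter]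

/-- Membership in `joinedSet`. -/
theorem mem_joinedSet {s : ℕ} {S : Set (Site 3)} {G : Finset (Site 3)} {x : Site 3}
    {ω : BondConfig (Site 3)} {y : Site 3} :
    y ∈ joinedSet s S G x ω ↔ y ∈ G ∧ ω ∈ DCT16.armEvent y s ∧ ω ∈ openConnIn S x y := by
  simp only [joinedSet, Finset.mem_filter]

/-- `largeSet s G ω ⊆ G`. -/
theorem largeSet_subset (s : ℕ) (G : Finset (Site 3)) (ω : BondConfig (Site 3)) : largeSet s G ω ⊆ G :=
  fun _ hy => (mem_largeSet.1 hy).1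

/-- `joinedSet ⊆ largeSet`. -/
theorem joinedSet_subset_largeSet (s : ℕ) (S : Set (Site 3)) (G : Finset (Site 3)) (x : Site 3)
    (ω : BondConfig (Site 3)) : joinedSet s S G x ω ⊆ largeSet s G ω :=
  fun _ hy => mem_largeSet.2 ⟨(mem_joinedSet.1 hy).1, (mem_joinedSet.1 hy).2.1⟩

/-- `largeSet` is monotone in the index set. -/
theorem largeSet_mono (s : ℕ) {G G' : Finset (Site 3)} (h : G ⊆ G') (ω : BondConfig (Site 3)) :
    largeSet s G ω ⊆ largeSet s G' ω :=
  fun _ hy => mem_largeSet.2 ⟨h (mem_largeSet.1 hy).1, (mem_largeSet.1 hy).2⟩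

/-- `joinedSet` is monotone in the index set. -/
theorem joinedSet_mono (s : ℕ) (S : Set (Site 3)) {G G' : Finset (Site 3)} (h : G ⊆ G') (x : Site 3)
    (ω : BondConfig (Site 3)) : joinedSet s S G x ω ⊆ joinedSet s S G' x ω :=
  fun _ hy => mem_joinedSet.2 ⟨h (mem_joinedSet.1 hy).1, (mem_joinedSet.1 hy).2⟩

/-- `joinedCount ≤ largeCount`. -/
theorem joinedCount_le_largeCount (s : ℕ) (S : Set (Site 3)) (G : Finset (Site 3)) (x : Site 3)
    (ω : BondConfig (Site 3)) : joinedCount s S G x ω ≤ largeCount s G ω :=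
  Finset.card_le_card (joinedSet_subset_largeSet s S G x ω)

/-- `largeCount ≤ #G`. -/
theorem largeCount_le_card (s : ℕ) (G : Finset (Site 3)) (ω : BondConfig (Site 3)) :
    largeCount s G ω ≤ G.card :=
  Finset.card_le_card (largeSet_subset s G ω)

/-- A base point with a joined point lies in the region `S` (in-`S` connections start in `S`). -/
theorem mem_of_joinedCount_pos {s : ℕ} {S : Set (Site 3)} {G : Finset (Site 3)} {x : Site 3}
    {ω : BondConfig (Site 3)} (h : 0 < joinedCount s S G x ω) : x ∈ S := by
  obtain ⟨y, hy⟩ := Finset.card_pos.1 h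
  obtain ⟨-, -, hxS, -, -⟩ := mem_joinedSet.1 hy
  exact hxS

/-! ## Measurability and the indicator-sum form of the counts -/

/-- The translated one-arm event is measurable (pull-back of the local event `siteToBoundary`). -/
theorem measurableSet_armEvent (v : Site 3) (n : ℕ) : MeasurableSet (DCT16.armEvent v n) := by
  rw [← DCT16.preimage_shift_siteToBoundary]
  exact (DCT16.measurableSet_siteToBoundary 3 n).preimage (BondConfig.relabel _).measurable

/-- `largeCount` as a sum of indicators (real-valued): `#{y ∈ G : y large} = Σ_{y ∈ G} 1_{y large}`. -/
theorem largeCount_eq_sum_indicator (s : ℕ) (G : Finset (Site 3)) (ω : BondConfig (Site 3)) :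
    (largeCount s G ω : ℝ) = ∑ y ∈ G, (DCT16.armEvent y s).indicator (fun _ => (1 : ℝ)) ω := by
  classical
  rw [largeCount, largeSet, Finset.card_filter]
  push_cast
  refine Finset.sum_congr rfl fun y _ => ?_
  by_cases h : ω ∈ DCT16.armEvent y s <;> simp [h]

/-- `joinedCount` as a sum of indicators (real-valued). -/
theorem joinedCount_eq_sum_indicator (s : ℕ) (S : Set (Site 3)) (G : Finset (Site 3)) (x : Site 3)
    (ω : BondConfig (Site 3)) :
    (joinedCount s S G x ω : ℝ) =
      ∑ y ∈ G, (DCT16.armEvent y s ∩ openConnIn S x y).indicator (fun _ => (1 : ℝ)) ω := by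
  classical
  rw [joinedCount, joinedSet, Finset.card_filter]
  push_cast
  refine Finset.sum_congr rfl fun y _ => ?_
  by_cases h : ω ∈ DCT16.armEvent y s ∧ ω ∈ openConnIn S x y
  · simp [h]
  · simp [h]

/-- `ω ↦ largeCount s G ω` is measurable (as a real-valued function). -/
theorem measurable_largeCount (s : ℕ) (G : Finset (Site 3)) :
    Measurable fun ω : BondConfig (Site 3) => (largeCount s G ω : ℝ) := by
  have h : (fun ω : BondConfig (Site 3) => (largeCount s G ω : ℝ)) =
      fun ω => ∑ y ∈ G, (DCT16.armEvent y s).indicator (fun _ => (1 : ℝ)) ω :=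
    funext (largeCount_eq_sum_indicator s G)
  rw [h]
  exact Finset.measurable_sum _ fun y _ => measurable_const.indicator (measurableSet_armEvent y s)

/-- `ω ↦ joinedCount s S G x ω` is measurable for a finite region `S` (as a real-valued function). -/
theorem measurable_joinedCount (s : ℕ) (S : Finset (Site 3)) (G : Finset (Site 3)) (x : Site 3) :
    Measurable fun ω : BondConfig (Site 3) => (joinedCount s ↑S G x ω : ℝ) := by
  have h : (fun ω : BondConfig (Site 3) => (joinedCount s ↑S G x ω : ℝ)) =
      fun ω => ∑ y ∈ G, (DCT16.armEvent y s ∩ openConnIn ↑S x y).indicator (fun _ => (1 : ℝ)) ω :=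
    funext (joinedCount_eq_sum_indicator s ↑S G x)
  rw [h]
  exact Finset.measurable_sum _ fun y _ =>
    measurable_const.indicator ((measurableSet_armEvent y s).inter (DCT16.measurableSet_openConnIn S x y))

/-! ## Elementary facts about the grid -/

/-- Coordinates of grid points. -/
@[simp] theorem gridPt_apply (s : ℕ) (z : Site 3) (i : Fin 3) :
    gridPt s z i = ((2 * s + 1 : ℕ) : ℤ) * z i := rfl

/-- `gridPt s` is injective (the mesh `2s+1` is positive). -/
theorem gridPt_injective (s : ℕ) : Function.Injective (gridPt s) := by
  intro z z' h
  funext i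
  have hi := congrFun h i
  simp only [gridPt_apply] at hi
  have hpos : (0 : ℤ) < ((2 * s + 1 : ℕ) : ℤ) := by positivity
  exact mul_left_cancel₀ hpos.ne' hi

/-- Membership in the core grid. -/
theorem mem_coreGrid {s m : ℕ} {y : Site 3} : y ∈ coreGrid s m ↔ ∃ z ∈ box 3 m, gridPt s z = y := by
  simp only [coreGrid, Finset.mem_image]

/-- The core grid has `(2m+1)³` points. -/
theorem card_coreGrid (s m : ℕ) : (coreGrid s m).card = (2 * m + 1) ^ 3 := by
  rw [coreGrid, Finset.card_image_of_injective _ (gridPt_injective s), card_box]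

/-- The core grid lies in the core `Λ(n)`, `n = (2s+1)m`. -/
theorem coreGrid_subset_box (s m : ℕ) : coreGrid s m ⊆ box 3 ((2 * s + 1) * m) := by
  intro y hy
  obtain ⟨z, hz, rfl⟩ := mem_coreGrid.1 hy
  rw [mem_box] at hz ⊢
  intro i
  have h := hz i
  have hs : (0 : ℤ) ≤ ((2 * s + 1 : ℕ) : ℤ) := by positivity
  simp only [gridPt_apply]
  push_cast at h ⊢
  constructor <;> nlinarith [h.1, h.2, hs]

/-- Half-grids are parts of the core grid. -/
theorem halfGrid_subset_coreGrid (s m : ℕ) (i : Fin 2) (b : Bool) : halfGrid s m i b ⊆ coreGrid s m :=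
  Finset.filter_subset _ _

/-- Distinct grid points are far apart: at sup-distance `≥ 2s+1` in some coordinate. -/
theorem exists_le_abs_sub_of_ne {s : ℕ} {z z' : Site 3} (h : gridPt s z ≠ gridPt s z') :
    ∃ i, ((2 * s + 1 : ℕ) : ℤ) ≤ |gridPt s z i - gridPt s z' i| := by
  have hne : z ≠ z' := fun hzz => h (hzz ▸ rfl)
  obtain ⟨i, hi⟩ : ∃ i, z i ≠ z' i := by
    by_contra hall
    push Not at hall
    exact hne (funext hall)
  refine ⟨i, ?_⟩
  simp only [gridPt_apply, ← mul_sub, abs_mul]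
  rw [abs_of_nonneg (by positivity : (0 : ℤ) ≤ ((2 * s + 1 : ℕ) : ℤ))]
  have h1 : (1 : ℤ) ≤ |z i - z' i| := Int.one_le_abs (sub_ne_zero.2 hi)
  nlinarith


/-! ## Locality of the dense block (the registered stub `stub_denseLocal` of the line) -/

/-- The translated one-arm event `armEvent y s` is determined by any set of pairs containing the pairs
inside `y + Λ(s)` (it is a union of in-`(y + Λ(s))` connection events). -/
theorem determinedBy_armEvent (y : Site 3) (s : ℕ) {F : Set (Sym2 (Site 3))}
    (hF : {z : Site 3 | z - y ∈ box 3 s}.sym2 ⊆ F) : DeterminedBy (DCT16.armEvent y s) F := by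
  have h : DCT16.armEvent y s =
      ⋃ a ∈ {a : Site 3 | a - y ∈ innerBoundary (zdGraph 3) (box 3 s)},
        openConnIn {z : Site 3 | z - y ∈ box 3 s} y a := by
    ext ω
    simp only [DCT16.armEvent, Set.mem_setOf_eq, Set.mem_iUnion, exists_prop]
  rw [h]
  exact DeterminedBy.iUnion fun a => DeterminedBy.iUnion fun _ =>
    DCT16.determinedBy_openConnIn _ y a hF

/-- For a core grid point `y` (`m ≥ 1`, `K ≥ 2`) the box `y + Λ(s)` lies inside `Λ(K n)`, `n = (2s+1)m`,
at the level of pairs. -/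
theorem sym2_ball_subset_of_mem_coreGrid {K s m : ℕ} (hK : 2 ≤ K) (hm : 1 ≤ m) {y : Site 3}
    (hy : y ∈ coreGrid s m) :
    {z : Site 3 | z - y ∈ box 3 s}.sym2 ⊆ (↑((box 3 (K * ((2 * s + 1) * m))).sym2) : Set (Sym2 (Site 3))) := by
  have hyb := mem_box.1 (coreGrid_subset_box s m hy)
  have hz : ∀ z : Site 3, z - y ∈ box 3 s → z ∈ box 3 (K * ((2 * s + 1) * m)) := by
    intro z hzy
    rw [mem_box] at hzy ⊢
    intro i
    have h1 := hzy i
    have h2 := hyb i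
    simp only [Pi.sub_apply] at h1
    have hm' : (1 : ℤ) ≤ m := by exact_mod_cast hm
    have hK' : (2 : ℤ) ≤ K := by exact_mod_cast hK
    have hs0 : (0 : ℤ) ≤ s := by positivity
    push_cast at h1 h2 ⊢
    have hn : (2 * (s : ℤ) + 1) * 1 ≤ (2 * (s : ℤ) + 1) * m := by nlinarith
    have hKn : 2 * ((2 * (s : ℤ) + 1) * m) ≤ K * ((2 * (s : ℤ) + 1) * m) := by nlinarith
    constructor <;> nlinarith [h1.1, h1.2, h2.1, h2.2]
  intro e he
  rw [Finset.coe_sym2]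
  induction e using Sym2.ind with
  | h a b =>
    rw [Set.mk_mem_sym2_iff] at he ⊢
    exact ⟨hz a he.1, hz b he.2⟩

/-- **Registered stub `stub_denseLocal` of crux stmt-CriticalPhenomena-0857 (line `registered`,
reshape 2)**: for `K ≥ 2` and `m ≥ 1` the dense block `denseBox K s m` is determined by the pairs inside
`Λ(K n)`, `n = (2s+1)m` — every counted predicate is either `ω ∈ armEvent y s` for a core grid point `y`
(determined by the pairs inside `y + Λ(s) ⊆ Λ(K n)`) or `ω ∈ openConnIn Λ(Kn) x y` (determined by the
pairs inside `Λ(Kn)`), so configurations agreeing on those pairs have the same counted sets. -/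
theorem stub_denseLocal :
    ∀ (K s m : ℕ), 2 ≤ K → 1 ≤ m →
      DeterminedBy (denseBox K s m) (↑((box 3 (K * ((2 * s + 1) * m))).sym2) : Set (Sym2 (Site 3))) := by
  intro K s m hK hm
  set F : Set (Sym2 (Site 3)) := ↑((box 3 (K * ((2 * s + 1) * m))).sym2) with hF
  rw [determinedBy_iff]
  intro ω ω' h
  have harm : ∀ y ∈ coreGrid s m, (ω ∈ DCT16.armEvent y s ↔ ω' ∈ DCT16.armEvent y s) := fun y hy =>
    (determinedBy_iff _ _).1 (determinedBy_armEvent y s (sym2_ball_subset_of_mem_coreGrid hK hm hy)) ω ω' h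
  have hconn : ∀ x y : Site 3,
      (ω ∈ openConnIn (↑(box 3 (K * ((2 * s + 1) * m))) : Set (Site 3)) x y ↔
        ω' ∈ openConnIn (↑(box 3 (K * ((2 * s + 1) * m))) : Set (Site 3)) x y) := fun x y =>
    (determinedBy_iff _ _).1 (DCT16.determinedBy_openConnIn _ x y (K := F) (by rw [hF, Finset.coe_sym2]))
      ω ω' h
  have hlarge : ∀ (i : Fin 2) (b : Bool),
      largeSet s (halfGrid s m i b) ω = largeSet s (halfGrid s m i b) ω' := by
    intro i b
    ext y
    simp only [mem_largeSet]
    constructor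
    · rintro ⟨hy, hl⟩; exact ⟨hy, (harm y (halfGrid_subset_coreGrid s m i b hy)).1 hl⟩
    · rintro ⟨hy, hl⟩; exact ⟨hy, (harm y (halfGrid_subset_coreGrid s m i b hy)).2 hl⟩
  have hjoined : ∀ (x : Site 3) (i : Fin 2) (b : Bool),
      joinedSet s ↑(box 3 (K * ((2 * s + 1) * m))) (halfGrid s m i b) x ω =
        joinedSet s ↑(box 3 (K * ((2 * s + 1) * m))) (halfGrid s m i b) x ω' := by
    intro x i b
    ext y
    simp only [mem_joinedSet]
    constructor
    · rintro ⟨hy, hl, hj⟩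
      exact ⟨hy, (harm y (halfGrid_subset_coreGrid s m i b hy)).1 hl, (hconn x y).1 hj⟩
    · rintro ⟨hy, hl, hj⟩
      exact ⟨hy, (harm y (halfGrid_subset_coreGrid s m i b hy)).2 hl, (hconn x y).2 hj⟩
  simp only [denseBox, Set.mem_setOf_eq, largeCount, joinedCount, hlarge, hjoined]

end Summit.CriticalPhenomena.PercolationContinuityZ3.Theorems.RenormaliseFromLinearLRO

end
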